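import Summits.NavierStokesRegularity.NavierStokesRegularity.Theses.SqueezeCycle
import Literature.Analysis.FluidPDE.TypeIAncientMild
import Literature.Analysis.FluidPDE.SelfSimilarLiouville
import HarnessLib

/-!
# Route `SqueezeCycle`, crux `ExtremalBiaxialitySubcritical` — the class `𝒦_C` is the tree's
Type-I KNSS-mild class, and the crux under the Liouville conjecture (L)

Helper file for item `stmt-NavierStokesRegularity-11609`
(`Summit.NavierStokesRegularity.NavierStokesRegularity.Theses.SqueezeCycle.ExtremalBiaxialitySubcritical`).

* `isTypeIAncientMild_of_squeezeClass` — the first four clauses of the route's inline class `𝒦_C`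
  (joint smoothness, `div u = 0`, the KNSS-mild Oseen identity written out through
  `UnboundedOperators.heatKernel`, the Type-I rate) are **literally** the tree's
  `Literature.Analysis.FluidPDE.IsTypeIAncientMild C u`: the written-out kernel is
  `Literature.Analysis.FluidPDE.oseenKernel` with its Gaussian weights `oseenWeightA/B`.
* `extremalBiaxialitySubcritical_of_squeezeLiouville` — the route target implies the crux
  (an everywhere-vanishing field has zero gradient, so an attained middle eigenvalue `≥ m` forces
  `m ≤ 0 < 1/8`).
* `squeezeLiouville_of_liouvilleConjectureNS` — the KNSS/Seregin–Šverák Liouville conjecture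
  (L) (`Literature.Analysis.FluidPDE.LiouvilleConjectureNS`, open) implies the route target: after
  a time shift a member of `𝒦_C` is a bounded ancient mild solution with continuous slices, (L)
  makes every slice constant, and the Oseen gauge plus the Type-I rate kill slice-constant
  elements (`IsTypeIAncientMild.eq_zero_of_slice_const`).
* `extremalBiaxialitySubcritical_of_liouvilleConjectureNS` — hence the crux holds under (L)
  (a CONDITIONAL result: (L) is open).
-/

noncomputable section

open MeasureTheory Set Function Filter
open scoped RealInnerProductSpace

namespace Summit.NavierStokesRegularity.NavierStokesRegularity.Theorems

open Literature.Analysis.FluidPDE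
open Summit.NavierStokesRegularity.NavierStokesRegularity.Theses

/-- **The route's inline class is the tree's Type-I KNSS-mild class.** The KNSS-mild clause of
`𝒦_C`, written out through `UnboundedOperators.heatKernel`, is the Oseen integral equation
`u(t) = e^{(t-s)Δ}u(s) - B¹_s(u,u)(t)` with the tree's `oseenKernel` (Koch–Tataru closed form with
the Gaussian weights `oseenWeightA`, `oseenWeightB`); together with joint smoothness,
`div u(t) = 0` and the Type-I rate this is `IsTypeIAncientMild C u`. [folklore] -/
theorem isTypeIAncientMild_of_squeezeClass {C : ℝ}
    {u : ℝ → EuclideanSpace ℝ (Fin 3) → EuclideanSpace ℝ (Fin 3)}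
    (h1 : ContDiffOn ℝ (⊤ : ℕ∞) (Function.uncurry u) (Set.Iio 0 ×ˢ Set.univ))
    (h2 : ∀ t < 0, Literature.Analysis.FluidPDE.VectorCalculus.IsDivFree (u t))
    (h3 : ∀ s t : ℝ, s < t → t < 0 → ∀ x, u t x =
      Literature.Analysis.FluidPDE.heatFlow (u s) (t-s) x - ∫ τ in Set.Ioo s t, ∫ y,
        ((-(inner ℝ (x-y) (u τ y) / (2*(t-τ)) *
          Literature.Analysis.UnboundedOperators.heatKernel (t-τ) (x-y))) • u τ y +
        (∫ σ in Set.Ioi (t-τ), Literature.Analysis.UnboundedOperators.heatKernel σ (x-y) / (4*σ^2)) •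
          (inner ℝ (x-y) (u τ y) • u τ y + inner ℝ (u τ y) (u τ y) • (x-y) +
            inner ℝ (x-y) (u τ y) • u τ y) -
        ((∫ σ in Set.Ioi (t-τ), Literature.Analysis.UnboundedOperators.heatKernel σ (x-y) / (8*σ^3)) *
          (inner ℝ (x-y) (u τ y) * inner ℝ (x-y) (u τ y))) • (x-y)))
    (h4 : Literature.Analysis.FluidPDE.HasTypeITimeDecay C u) :
    IsTypeIAncientMild C u := by
  rw [isTypeIAncientMild_iff]
  refine ⟨h1, h2, fun s t hst ht x => ?_, h4⟩
  rw [h3 s t hst ht x]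
  rfl

/-- **An everywhere-vanishing slice has no squeeze**: if `u t₀ x = 0` for all `x` then the
Courant–Fischer lower-bound clause "the quadratic form of `(−t₀)∇u(t₀,x₀)` is `≥ m|·|²` on an
orthonormal 2-frame" forces `m ≤ 0` (the gradient of the zero slice vanishes; test `α = 1`,
`β = 0`). [folklore] -/
theorem nonpos_of_twoFrame_lower_of_slice_zero {m t₀ : ℝ}
    {u : ℝ → EuclideanSpace ℝ (Fin 3) → EuclideanSpace ℝ (Fin 3)} {x₀ : EuclideanSpace ℝ (Fin 3)}
    (hz : ∀ x, u t₀ x = 0)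
    (hGE : ∃ v w : EuclideanSpace ℝ (Fin 3), ‖v‖ = 1 ∧ ‖w‖ = 1 ∧ inner ℝ v w = 0 ∧ ∀ α β : ℝ,
      m * (α^2 + β^2) ≤ (-t₀) * inner ℝ (fderiv ℝ (u t₀) x₀ (α • v + β • w)) (α • v + β • w)) :
    m ≤ 0 := by
  obtain ⟨v, w, -, -, -, hαβ⟩ := hGE
  have hu0 : u t₀ = fun _ => 0 := funext hz
  have h := hαβ 1 0
  rw [hu0] at h
  simpa using h

/-- **The route target implies the crux**: under `SqueezeLiouville` every element of `𝒦_C`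
vanishes on `t < 0`, so at the attainment point the gradient is zero and the attained value
`m` of the Leray-gauge middle strain eigenvalue satisfies `m ≤ 0 < 1/8` (the maximality clause
is not needed). [folklore] -/
theorem extremalBiaxialitySubcritical_of_squeezeLiouville (hL : SqueezeCycle.SqueezeLiouville) :
    SqueezeCycle.ExtremalBiaxialitySubcritical := by
  intro C m u t₀ x₀ ht₀ hu hGE _hmax
  have hz : ∀ x, u t₀ x = 0 := fun x => hL C u hu t₀ ht₀ x
  have hm : m ≤ 0 := nonpos_of_twoFrame_lower_of_slice_zero hz hGE
  linarith

/-- **A Type-I KNSS-mild ancient field vanishes under the Liouville conjecture (L).** For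
`δ > 0` the shifted field `t ↦ u(t − δ)` is a bounded ancient mild solution in the duality sense
(`IsTypeIAncientMild.isBoundedAncientMildSolution_sub`) with continuous, hence measurable,
slices; (L) (`LiouvilleConjectureNS`) makes every slice a.e. — hence everywhere — constant, and
a slice-constant Type-I KNSS-mild field is zero (`IsTypeIAncientMild.eq_zero_of_slice_const`:
the Oseen gauge fixes the constant in time and the Type-I rate sends it to `0`); finally
`u(t) = u((t + δ) − δ)` with `δ = −t/2`. [cite: KochNadirashviliSereginSverak2009, §1 conjecture (L) and Remark 6.1 (arXiv:0709.3599)] -/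
theorem typeIAncientMild_eq_zero_of_liouvilleConjectureNS (hL : LiouvilleConjectureNS) {C : ℝ}
    {u : ℝ → EuclideanSpace ℝ (Fin 3) → EuclideanSpace ℝ (Fin 3)} (h : IsTypeIAncientMild C u)
    {t : ℝ} (ht : t < 0) (x : EuclideanSpace ℝ (Fin 3)) : u t x = 0 := by
  set δ : ℝ := -t / 2 with hδ
  have hδ0 : 0 < δ := by rw [hδ]; linarith
  -- the shifted field
  set w : ℝ → EuclideanSpace ℝ (Fin 3) → EuclideanSpace ℝ (Fin 3) := fun s => u (s - δ) with hw
  have hwT : IsTypeIAncientMild C w := h.comp_sub_right hδ0.le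
  have hwB : IsBoundedAncientMildSolution 1 w := h.isBoundedAncientMildSolution_sub hδ0
  have hwm : ∀ s < 0, AEStronglyMeasurable (w s) volume := fun s hs =>
    hwT.aestronglyMeasurable_slice hs
  -- (L): every slice of `w` is a.e. constant, hence constant
  have hconst : ∀ s < 0, ∃ b : EuclideanSpace ℝ (Fin 3), ∀ y, w s y = b := by
    intro s hs
    obtain ⟨b, hb⟩ := hL w hwB hwm s hs
    refine ⟨b, fun y => ?_⟩
    have hc : w s = fun _ => b :=
      ((hwT.continuous_slice hs).ae_eq_iff_eq volume continuous_const).1 hb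
    exact congrFun hc y
  choose! b hb using hconst
  have hzero : ∀ s < 0, ∀ y, w s y = 0 := fun s hs y =>
    hwT.eq_zero_of_slice_const (fun s' hs' y' => hb s' hs' y') hs y
  have key := hzero (t + δ) (by rw [hδ]; linarith) x
  simpa only [hw, add_sub_cancel_right] using key

/-- **(L) implies the route target `SqueezeLiouville`**: an element of `𝒦_C` is a Type-I
KNSS-mild ancient field (`isTypeIAncientMild_of_squeezeClass`; the scaled-energy clause is not
needed), which vanishes under the Liouville conjecture (L) of Koch–Nadirashvili–Seregin–Šverák
(`typeIAncientMild_eq_zero_of_liouvilleConjectureNS`). CONDITIONAL on the open conjecture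
`LiouvilleConjectureNS`. [cite: KochNadirashviliSereginSverak2009, §1 conjecture (L) (arXiv:0709.3599)] -/
theorem squeezeLiouville_of_liouvilleConjectureNS (hL : LiouvilleConjectureNS) :
    SqueezeCycle.SqueezeLiouville := by
  intro C u hu t ht x
  obtain ⟨h1, h2, h3, h4, -⟩ := hu
  exact typeIAncientMild_eq_zero_of_liouvilleConjectureNS hL
    (isTypeIAncientMild_of_squeezeClass h1 h2 h3 h4) ht x

/-- **The crux `ExtremalBiaxialitySubcritical` holds under the Liouville conjecture (L)**
(composition of `squeezeLiouville_of_liouvilleConjectureNS` and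
`extremalBiaxialitySubcritical_of_squeezeLiouville`). CONDITIONAL on the open conjecture
`Literature.Analysis.FluidPDE.LiouvilleConjectureNS`; it does not close the item. [cite: KochNadirashviliSereginSverak2009, §1 conjecture (L) (arXiv:0709.3599)] -/
theorem extremalBiaxialitySubcritical_of_liouvilleConjectureNS (hL : LiouvilleConjectureNS) :
    SqueezeCycle.ExtremalBiaxialitySubcritical :=
  extremalBiaxialitySubcritical_of_squeezeLiouville (squeezeLiouville_of_liouvilleConjectureNS hL)

end Summit.NavierStokesRegularity.NavierStokesRegularity.Theorems

end
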